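/-
Copyright (c) 2026 the pub-hodgecm-mathlib formalisation cell (harness21).  Prover seat hodgecm-mathlib-LH4-p16 (g2), req620 Track A «(D-RAM) FOUR-FRAME» squad
(STAGE-1b, row (2) of the piece `f_{T₊}`, the (β₂) road (R-36); β₂ sub-dealer LH4-p04 (g9), lane-C hinge LH7-p10 (g2); MECH-K2 v1 §4 «(ROW-INT)_C»: K5-C,
third file), 2026-09-04.
-/
import Summits.HodgeConjecture.HodgeConjecture.Theorems.F0P3cDyRamConeCellLabelBalance    -- ★ (LH4-p12): `dualGen_mul_left`, the `ε •` bookkeeping for `εΘε = 1`; brings ★ DEFS `IsOrd ∕ dualGen ∕ levelSet ∕ levelSetDep`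
import HarnessLib

/-!
# Crux `H413`, line LH4 «(D-RAM) FOUR-FRAME» — STAGE-1b, row (2), the (β₂) road (R-36), lane C, (ROW-INT)_C, K5-C (3): «A UNIT FLIP WITH SMALL SKEW KEEPS A ROW CELL» — the
# five `levelSet` clauses and the depth clause for `ε • Λ`, `|εΘε| = 1`, when `εΘε` is `ρ`-fixed to the lattice's own precision

Cell `hodgecm-mathlib` (D-0151), FLOOR 0, crux item H413 = `stmt-HodgeConjecture-24833`, route of record `HCCMUnconditional`; squad F0∕P3c∕LH4; lane
`--supports stmt-HodgeConjecture-24833 --as helper` (count-neutral; pays NO tier-0 row).  THEOREMS ONLY (no `def`, no instance, no notation, no `sorry`, default heartbeats);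
★-only imports; states NO law; (β₂) stays a HYPOTHESIS.  DATUM-FREE one-field letters (`K` with `ρ`, `Θ`, `α`; ★ DEFS).
WHY (MECH-K2 v1 §4 `F0/P3c/LH4/LH4-p16/g2/MECH-K2.v1.LH4p16g2.md`; K5-C (1) ★-cand `…RowVertexCoordinateChange`, K5-C (2) ★-cand `…ThetaNormClassReciprocity`; lane-B twin: LH4-p19 (g2) ★
`…DiagonalCellFibreTransport`; the norm-ONE case is ★ `…ConeCellLabelBalance.smul_mem_levelSet_iff`).  (ROW-INT)_C counts the vertices of a lane-C row cell through the digit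
`V(Λ)`; the fibres over two digits are compared by the flip `Λ ↦ ε • Λ` whose `Θ`-norm `N = εΘε` is a UNIT (not `1`): the dual generator becomes `N·Y` (★ `dualGen_mul_left`), and the
cell's clauses survive iff the skew of `N` is invisible at the lattice: `|N − ρN|·|Y| < |Y − ρY|`.  THIS FILE proves exactly that bookkeeping:
* §1 `mul_sub_map_mul_eq`, `v_mul_sub_map_mul_eq_of_skew`: `NY − ρ(NY) = N(Y − ρY) + (N − ρN)ρY`, so `|NY − ρ(NY)| = |Y − ρY|` under the skew letter;
* §2 `isOrd_mul_iff_of_skew`, `isOrd_mul_div_iff_of_skew`: integrality and primitivity of `N·Y` ⟺ those of `Y`;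
* §3 `isOrd_div_mul_of_skew`: the DEPTH clause `μ∕(N·Y) ∈ 𝒪_cc` from `μ∕Y ∈ 𝒪_cc` when `|μ| ≤ |Y|²` (the row: `|μ| = |Y|²·|ϖ|^{d%2}`) and `Y ∈ 𝒪_cc`;
* §4 HEADS `smul_mem_levelSet_of_skew`, `smul_mem_levelSetDep_of_skew`: `ε • Λ ∈ levelSet(j, a)` (resp. `levelSetDep(j, a; μ)`) with generator `ε·x₀`.
With K5-C (1) §4 (the transport multiplier lands on a prescribed digit) and K5-C (2) (which multipliers are `Θ`-norms), this is the fibre-exchange engine of lane C.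
WHAT IS NOT CLAIMED: the existence of `ε` with prescribed `εΘε` (K5-C (2)'s class condition), any count, the digit bookkeeping of the skew letter per cell (tokens: `|Y| = |ϖE|^b`,
`|Y − ρY| = |ϖE^j(α − ρα)|·(unit)` on Gram-primitive vertices).
HONEST LABEL.  Count-neutral lattice bookkeeping; nothing printed is asserted; no census law is stated; `HC_CM` is proved only modulo the 7 printed citations (2 remaining named inputs:
hLiu418 = `stmt-HodgeConjecture-24832`, h413 = `stmt-HodgeConjecture-24833`) until rung 0 closes.
## References
* [Jacobowitz1962] R. Jacobowitz, *Hermitian forms over local fields*, Amer. J. Math. 84 (1962): §4 (dual lattices, gluing).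
* [Kottwitz1986BaseChangeUnits] R. E. Kottwitz, *Base change for unit elements of Hecke algebras*, Compositio Math. 60 (1986): §1 pp. 240–241 (fixed-lattice counts).
* [Serre1979] J.-P. Serre, *Local Fields*, GTM 67 (1979): Ch. III §6 Prop. 12 (orders), Ch. V §3 Cor. 3.
-/

set_option autoImplicit false

noncomputable section

namespace Summit.HodgeConjecture.HodgeConjecture.Cruxes.H413.F0P3cDyRamRowCellFlipTransport

open scoped Valued WithZero Pointwise
open WithZero
open Summit.HodgeConjecture.HodgeConjecture.Cruxes.H413.F0P3cDyRamToricCensusDefs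
open Summit.HodgeConjecture.HodgeConjecture.Cruxes.H413.F0P3cDyRamConeCellLabelBalance (dualGen_mul_left)

variable {K : Type} [Field K] [Valued K ℤᵐ⁰] {ρ Θ : K →+* K} {α : K}

/-! ## §1 The skew of `N·Y` -/

omit [Valued K ℤᵐ⁰] in
/-- `N·Y − ρ(N·Y) = N·(Y − ρY) + (N − ρN)·ρY`. [cite: Serre1979, Ch. III §6 Prop. 12] -/
theorem mul_sub_map_mul_eq (ρ : K →+* K) (N Y : K) : N * Y - ρ (N * Y) = N * (Y - ρ Y) + (N - ρ N) * ρ Y := by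
  rw [map_mul]; ring

/-- **THE SKEW LETTER**: `|N| = 1`, `|N − ρN|·|Y| < |Y − ρY|` ⟹ `|N·Y − ρ(N·Y)| = |Y − ρY|`. [cite: Serre1979, Ch. III §6 Prop. 12] -/
theorem v_mul_sub_map_mul_eq_of_skew (hvρ : ∀ x, Valued.v (ρ x) = Valued.v x) {N Y : K} (hN1 : Valued.v N = 1)
    (hsk : Valued.v (N - ρ N) * Valued.v Y < Valued.v (Y - ρ Y)) :
    Valued.v (N * Y - ρ (N * Y)) = Valued.v (Y - ρ Y) := by
  rw [mul_sub_map_mul_eq ρ N Y]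
  have h1 : Valued.v (N * (Y - ρ Y)) = Valued.v (Y - ρ Y) := by rw [Valuation.map_mul, hN1, one_mul]
  have h2 : Valued.v ((N - ρ N) * ρ Y) < Valued.v (N * (Y - ρ Y)) := by rwa [Valuation.map_mul, hvρ, h1]
  rw [Valuation.map_add_eq_of_lt_left _ h2, h1]

/-! ## §2 Integrality and primitivity of `N·Y` -/

/-- **`N·Y ∈ 𝒪_cc ⟺ Y ∈ 𝒪_cc`** under the skew letter (`|N| = 1`). [cite: Serre1979, Ch. III §6 Prop. 12] -/
theorem isOrd_mul_iff_of_skew (hvρ : ∀ x, Valued.v (ρ x) = Valued.v x) {N Y : K} (hN1 : Valued.v N = 1)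
    (hsk : Valued.v (N - ρ N) * Valued.v Y < Valued.v (Y - ρ Y)) (cc : K) :
    IsOrd ρ α cc (N * Y) ↔ IsOrd ρ α cc Y := by
  rw [isOrd_iff, isOrd_iff, v_mul_sub_map_mul_eq_of_skew hvρ hN1 hsk, Valuation.map_mul, hN1, one_mul]

/-- **`N·Y∕ϖE ∈ 𝒪_cc ⟺ Y∕ϖE ∈ 𝒪_cc`** under the skew letter (`|N| = 1`, `ρϖE = ϖE ≠ 0`): Gram-primitivity transfers. [cite: Serre1979, Ch. III §6 Prop. 12] [cite: Jacobowitz1962, §4] -/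
theorem isOrd_mul_div_iff_of_skew (hvρ : ∀ x, Valued.v (ρ x) = Valued.v x) {N Y ϖE : K} (hN1 : Valued.v N = 1)
    (hsk : Valued.v (N - ρ N) * Valued.v Y < Valued.v (Y - ρ Y)) (hρϖ : ρ ϖE = ϖE) (cc : K) :
    IsOrd ρ α cc (N * Y / ϖE) ↔ IsOrd ρ α cc (Y / ϖE) := by
  have e1 : N * Y / ϖE - ρ (N * Y / ϖE) = (N * Y - ρ (N * Y)) / ϖE := by rw [map_div₀, hρϖ, sub_div]
  have e2 : Y / ϖE - ρ (Y / ϖE) = (Y - ρ Y) / ϖE := by rw [map_div₀, hρϖ, sub_div]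
  rw [isOrd_iff, isOrd_iff, e1, e2, map_div₀, map_div₀, map_div₀, map_div₀, v_mul_sub_map_mul_eq_of_skew hvρ hN1 hsk, Valuation.map_mul, hN1,
    one_mul]

/-! ## §3 The depth clause -/

/-- **THE DEPTH CLAUSE SURVIVES**: `μ∕Y ∈ 𝒪_cc`, `Y ∈ 𝒪_cc`, `|μ| ≤ |Y|²`, `|N| = 1` and the skew letter ⟹ `μ∕(N·Y) ∈ 𝒪_cc`
(`μ∕(NY) − ρ(μ∕(NY)) = [(μ∕Y − ρ(μ∕Y))·ρN + ρ(μ∕Y)·(ρN − N)]∕(N·ρN)` and `|μ∕Y|·|N − ρN| < |μ|·|Y − ρY|∕|Y|² ≤ |cc(α − ρα)|`).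
[cite: Kottwitz1986BaseChangeUnits, §1 pp. 240–241] [cite: Serre1979, Ch. III §6 Prop. 12] -/
theorem isOrd_div_mul_of_skew (hvρ : ∀ x, Valued.v (ρ x) = Valued.v x) {N Y μ cc : K} (hN1 : Valued.v N = 1)
    (hsk : Valued.v (N - ρ N) * Valued.v Y < Valued.v (Y - ρ Y)) (hY : IsOrd ρ α cc Y) (hμY : Valued.v μ ≤ Valued.v Y ^ 2)
    (hP : IsOrd ρ α cc (μ / Y)) : IsOrd ρ α cc (μ / (N * Y)) := by
  have hN0 : N ≠ 0 := fun h0 => by rw [h0, map_zero] at hN1; exact zero_ne_one hN1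
  have hρN0 : ρ N ≠ 0 := (map_ne_zero ρ).2 hN0
  have hρN1 : Valued.v (ρ N) = 1 := by rw [hvρ, hN1]
  by_cases hY0 : Y = 0
  · rw [hY0, mul_zero, div_zero]; rw [hY0, div_zero] at hP; exact hP
  have hvY0 : Valued.v Y ≠ 0 := (Valuation.ne_zero_iff _).2 hY0
  refine ⟨?_, ?_⟩
  · rw [map_div₀, Valuation.map_mul, hN1, one_mul, ← map_div₀]; exact hP.1
  · have e : μ / (N * Y) - ρ (μ / (N * Y)) = ((μ / Y - ρ (μ / Y)) * ρ N + ρ (μ / Y) * (ρ N - N)) / (N * ρ N) := by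
      rw [map_div₀, map_mul, map_div₀]; field_simp; ring
    rw [e, map_div₀, Valuation.map_mul, hN1, hρN1, mul_one, div_one]
    refine (Valuation.map_add _ _ _).trans (max_le ?_ ?_)
    · rw [Valuation.map_mul, hρN1, mul_one]; exact hP.2
    · -- `|ρ(μ∕Y)|·|ρN − N| ≤ |cc(α − ρα)|`
      rw [Valuation.map_mul, hvρ, ← Valuation.map_neg _ (ρ N - N), neg_sub, map_div₀]
      have h1 : Valued.v (N - ρ N) * Valued.v Y < Valued.v (cc * (α - ρ α)) := lt_of_lt_of_le hsk hY.2
      have h2 : Valued.v μ / Valued.v Y ≤ Valued.v Y := by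
        rw [div_le_iff₀ (zero_lt_iff.2 hvY0), ← pow_two]; exact hμY
      calc Valued.v μ / Valued.v Y * Valued.v (N - ρ N) ≤ Valued.v Y * Valued.v (N - ρ N) := mul_le_mul' h2 le_rfl
        _ = Valued.v (N - ρ N) * Valued.v Y := mul_comm _ _
        _ ≤ Valued.v (cc * (α - ρ α)) := h1.le

/-! ## §4 HEADS — `ε • Λ` keeps the cell -/

/-- **HEAD — «A UNIT FLIP WITH SMALL SKEW KEEPS THE u-FREE CELL».**  `Λ = x₀·𝒪_j` with dual generator `Y = dualGen ρ Θ α (ϖE^j) h x₀` integral, Gram-primitive, of level `a`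
(the five `levelSet` clauses with THIS `x₀`), `ρϖE = ϖE`, and a flip `ε` with `|εΘε| = 1` and `|εΘε − ρ(εΘε)|·|Y| < |Y − ρY|` ⟹ `ε • Λ ∈ levelSet ρ Θ α ϖE h j a`, presented by `ε·x₀`
with dual generator `(εΘε)·Y` (★ `dualGen_mul_left`). [cite: Jacobowitz1962, §4] [cite: Kottwitz1986BaseChangeUnits, §1 pp. 240–241] -/
theorem smul_mem_levelSet_of_skew (hvρ : ∀ x, Valued.v (ρ x) = Valued.v x) {ϖE h : K} (hρϖ : ρ ϖE = ϖE)
    {j a : ℕ} {Λ : AddSubgroup K} {x₀ ε : K} (hx₀ : x₀ ≠ 0) (hmem : ∀ x, x ∈ Λ ↔ ∃ z, IsOrd ρ α (ϖE ^ j) z ∧ x = x₀ * z)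
    (hyO : IsOrd ρ α (ϖE ^ j) (dualGen ρ Θ α (ϖE ^ j) h x₀)) (hyprim : ¬ IsOrd ρ α (ϖE ^ j) (dualGen ρ Θ α (ϖE ^ j) h x₀ / ϖE))
    (hylev : Valued.v (dualGen ρ Θ α (ϖE ^ j) h x₀) = Valued.v ϖE ^ a)
    (hN1 : Valued.v (ε * Θ ε) = 1)
    (hsk : Valued.v (ε * Θ ε - ρ (ε * Θ ε)) * Valued.v (dualGen ρ Θ α (ϖE ^ j) h x₀) <
      Valued.v (dualGen ρ Θ α (ϖE ^ j) h x₀ - ρ (dualGen ρ Θ α (ϖE ^ j) h x₀))) :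
    ε • Λ ∈ levelSet ρ Θ α ϖE h j a := by
  have hε0 : ε ≠ 0 := fun h0 => by rw [h0, zero_mul, map_zero] at hN1; exact zero_ne_one hN1
  refine ⟨ε * x₀, mul_ne_zero hε0 hx₀, fun x => ?_, ?_, ?_, ?_⟩
  · rw [AddSubgroup.mem_smul_pointwise_iff_exists]
    constructor
    · rintro ⟨s, hs, rfl⟩
      obtain ⟨z, hz, rfl⟩ := (hmem s).1 hs
      exact ⟨z, hz, by rw [smul_eq_mul, mul_assoc]⟩
    · rintro ⟨z, hz, rfl⟩
      exact ⟨x₀ * z, (hmem _).2 ⟨z, hz, rfl⟩, by rw [smul_eq_mul, mul_assoc]⟩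
  · rw [dualGen_mul_left]; exact (isOrd_mul_iff_of_skew hvρ hN1 hsk _).2 hyO
  · rw [dualGen_mul_left]; exact fun h' => hyprim ((isOrd_mul_div_iff_of_skew hvρ hN1 hsk hρϖ _).1 h')
  · rw [dualGen_mul_left, Valuation.map_mul, hN1, one_mul, hylev]

/-- **HEAD′ — «… AND KEEPS THE DEPTH-REFINED CELL».**  Same letters plus the depth clause of `Λ` in `y`-currency (`μ∕Y ∈ 𝒪_j`, ★ DEFS `forall_herm_mul_mem_iff_isOrd_div`), the row
size letter `|μ| ≤ |Y|²` and the line-model letters of ★ DEFS (`ρ`, `Θ` commuting involutive isometries, `|α| ≤ 1`, integrality of `(z − ρz)∕(α − ρα)`, `h ≠ 0`, `ρ(ϖE^j) = ϖE^j ≠ 0`,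
`|ϖE^j| ≤ 1`) ⟹ `ε • Λ ∈ levelSetDep ρ Θ α ϖE h j a μ`. [cite: Jacobowitz1962, §4] [cite: Kottwitz1986BaseChangeUnits, §1 pp. 240–241] -/
theorem smul_mem_levelSetDep_of_skew (hρρ : ∀ x, ρ (ρ x) = x) (hvρ : ∀ x, Valued.v (ρ x) = Valued.v x) (hα : ρ α ≠ α) (hα1 : Valued.v α ≤ 1)
    (hint : ∀ z : K, Valued.v z ≤ 1 → Valued.v ((z - ρ z) / (α - ρ α)) ≤ 1)
    (hΘΘ : ∀ x, Θ (Θ x) = x) (hΘρ : ∀ x, Θ (ρ x) = ρ (Θ x)) (hvΘ : ∀ x, Valued.v (Θ x) = Valued.v x)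
    {ϖE h : K} (hρϖ : ρ ϖE = ϖE) (hϖ0 : ϖE ≠ 0) (hϖ1 : Valued.v ϖE ≤ 1) (hh : h ≠ 0)
    {j a : ℕ} {Λ : AddSubgroup K} {x₀ ε μ : K} (hx₀ : x₀ ≠ 0) (hmem : ∀ x, x ∈ Λ ↔ ∃ z, IsOrd ρ α (ϖE ^ j) z ∧ x = x₀ * z)
    (hyO : IsOrd ρ α (ϖE ^ j) (dualGen ρ Θ α (ϖE ^ j) h x₀)) (hyprim : ¬ IsOrd ρ α (ϖE ^ j) (dualGen ρ Θ α (ϖE ^ j) h x₀ / ϖE))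
    (hylev : Valued.v (dualGen ρ Θ α (ϖE ^ j) h x₀) = Valued.v ϖE ^ a)
    (hdep : IsOrd ρ α (ϖE ^ j) (μ / dualGen ρ Θ α (ϖE ^ j) h x₀)) (hμY : Valued.v μ ≤ Valued.v (dualGen ρ Θ α (ϖE ^ j) h x₀) ^ 2)
    (hN1 : Valued.v (ε * Θ ε) = 1)
    (hsk : Valued.v (ε * Θ ε - ρ (ε * Θ ε)) * Valued.v (dualGen ρ Θ α (ϖE ^ j) h x₀) <
      Valued.v (dualGen ρ Θ α (ϖE ^ j) h x₀ - ρ (dualGen ρ Θ α (ϖE ^ j) h x₀))) :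
    ε • Λ ∈ levelSetDep ρ Θ α ϖE h j a μ := by
  have hε0 : ε ≠ 0 := fun h0 => by rw [h0, zero_mul, map_zero] at hN1; exact zero_ne_one hN1
  have hΛ' := smul_mem_levelSet_of_skew (α := α) (Θ := Θ) hvρ hρϖ hx₀ hmem hyO hyprim hylev hN1 hsk
  refine ⟨hΛ', ?_⟩
  -- the presentation of `ε • Λ` by `ε·x₀`
  have hmem' : ∀ x, x ∈ ε • Λ ↔ ∃ z, IsOrd ρ α (ϖE ^ j) z ∧ x = ε * x₀ * z := fun x => by
    rw [AddSubgroup.mem_smul_pointwise_iff_exists]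
    constructor
    · rintro ⟨s, hs, rfl⟩
      obtain ⟨z, hz, rfl⟩ := (hmem s).1 hs
      exact ⟨z, hz, by rw [smul_eq_mul, mul_assoc]⟩
    · rintro ⟨z, hz, rfl⟩
      exact ⟨x₀ * z, (hmem _).2 ⟨z, hz, rfl⟩, by rw [smul_eq_mul, mul_assoc]⟩
  have hcc : ρ (ϖE ^ j) = ϖE ^ j := by rw [map_pow, hρϖ]
  have hcc0 : ϖE ^ j ≠ 0 := pow_ne_zero _ hϖ0
  have hcc1 : Valued.v (ϖE ^ j) ≤ 1 := by rw [Valuation.map_pow]; exact pow_le_one₀ zero_le hϖ1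
  rw [forall_herm_mul_mem_iff_isOrd_div hρρ hvρ hα hα1 hint hΘΘ hΘρ hvΘ hcc hcc0 hcc1 hh (mul_ne_zero hε0 hx₀) hmem' μ, dualGen_mul_left]
  exact isOrd_div_mul_of_skew hvρ hN1 hsk hyO hμY hdep

end Summit.HodgeConjecture.HodgeConjecture.Cruxes.H413.F0P3cDyRamRowCellFlipTransport

end
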